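import Summits.QuantumFields.BalabanUV.T4Continuum.Support.RegionBlockExtensionEnergy
import Summits.QuantumFields.BalabanUV.T4Continuum.Support.RegionGaugeSliceOrthRegion

/-!
# `BalabanUV.T4Continuum.Support.RegionGradientTwoScale` — NE2 (node U1a) formalisation swarm, SUPPLIER item «Δ1-COERC-ORTH» under the
# owner's sub-row `T4-U1a.S-NE2-D1-DIRICHLET°` (vector layer, W1): THE TWO-SCALE ELLIPTIC ESTIMATE ON A UNION OF UNIT BLOCKS and THE
# GRADIENT SECTOR OF THE DISPLAYED ORTHOGONAL-SLICE INEQUALITY — a Dirichlet scalar `φ` on `Ω` whose region Laplacian is BLOCK-CONSTANT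
# obeys `nsq (∂_Ωφ) ≤ Cext(d)·n^d·nsq (Q∂_Ωφ)`, uniformly in `n ≥ 2`, `M`, `S`; hence `OrthSliceCoercive` HOLDS on pure gauges with the
# explicit constant `a/Cext(d)` (unit b2b-balaban-t4-ne2-formalise-leaf-09, gen 8, v1)

HONEST FRAMING (T4-DAG p. 1).  [folklore] `U = 1` lattice calculus on ONE region (any decidable set `S` of unit blocks), finite torus, `2 ≤ n`;
a PARTIAL result on the displayed W1 inequality: its GRADIENT sector only — the transverse (divergence-free) sector and the coupling of the two
in the mass term stay OPEN (memo `t4/T4-EST-NE2-D1-COERC.md` §6); nothing printed is a hypothesis; NE2 (U1a) NOT proved; spine PROVED 0/9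
unchanged; NOT [B9] (3.23)–(3.27) as printed; NOT infinite volume, NOT the mass gap, NOT Clay.  HONEST DEPENDENCY (verbatim): «continuum YM on
T⁴ ⇐ BetaPertH ∧ nine spine estimates (0/9 proved); BetaPertH ⇐ (D1) ∧ (D4) ∧ CAP+tail; G-an2-4 gates asym, D1 and NE2/3/4.»

WHAT THIS FILE PROVES (0 sorry; `RegionBlockExtension(Energy)` + `RegionGaugeSliceOrth(Region)` + leaf-07-g5's «Q∂ = ∂₁Q′» `avgR_mul_gradR` BY NAME):
 * §1 dictionary: `grad1R_mulVec` (`∇₁` of a block function on `S` = `∇₁` of its zero-extension), **`nsq_gradR_blockExt_le`**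
   (`nsq (∂_Ω E g) ≤ Cext·n^d·nsq (∇₁ g)` — file 2's energy bound read on the region carriers).
 * §2 **THE TWO-SCALE ESTIMATE `nsq_gradR_le_of_lap_const`**: `∂_Ωᴴ∂_Ωφ = Q′_Ωᴴc ⟹ nsq (∂_Ωφ) ≤ Cext d·n^d·nsq (Q(∂_Ωφ))` — ONE Cauchy–Schwarz:
   `nsq (∂φ) = ⟨φ, Q′ᴴc⟩ = ⟨Q′φ, c⟩ = ⟨Q′E(Q′φ), c⟩ = ⟨∂E(Q′φ), ∂φ⟩ ≤ ‖∂E(Q′φ)‖·‖∂φ‖`, then the energy bound and `∇₁(Q′φ) = Q(∂_Ωφ)`.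
 * §3 **`orthSlice_gradient`**: for every pure gauge `A = ∂_Ωφ` orthogonal to the residual gauge directions `∂_Ω N(Q′_Ω)` (equivalently:
   with block-constant region divergence), `(a/Cext d)·nsq A ≤ nsq (curlR A) + a n^d·nsq (avgR A)` — the displayed inequality
   `OrthSliceCoercive (curlR …) (gradR …) (QOm …) (avgR …) (a·n^d) (a/Cext d)` RESTRICTED TO GRADIENTS is a theorem (`0 ≤ a`, `2 ≤ n`).

ABSOLUTE RULE (cell, verbatim): «No internally-minted statement may enter as a cited fact. Every hypothesis is either kernel-proved in
this package or a verbatim quotation of a PUBLISHED theorem with page reference. The manuscript(s) under audit are NOT citable for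
their own disputed steps — they are the thing under adjudication; programme-internal (2001/route/tribunal) claims are never citable.»
[folklore] throughout; no `def … : Prop`.  NOT CLAIMED: the orthogonal-slice inequality beyond gradients; NE2; NE3; «not in print; our proof».
-/

noncomputable section

open scoped BigOperators ComplexConjugate Matrix

namespace Summit.QuantumFields.BalabanUV.T4Continuum.RegionGradientTwoScale

open Literature.MathematicalPhysics.QuantumFieldTheory.Balaban1983to89.B5Prop11Plancherel (Tor fine unitVec)
open Literature.MathematicalPhysics.QuantumFieldTheory.Balaban1983to89.B5Prop11Lower (nsq nsq_nonneg star_dotProduct_self)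
open Literature.MathematicalPhysics.QuantumFieldTheory.Balaban1983to89.B5Action121 (GradOp star_mulVec_dotProduct
  dotProduct_mulVec_eq_star_conjTranspose_mulVec)
open Summit.QuantumFields.BalabanUV.T4Continuum
open Summit.QuantumFields.BalabanUV.T4Continuum.SubtypeCompression (ext ext_apply_of ext_apply_of_not)
open Summit.QuantumFields.BalabanUV.T4Continuum.ScalarAveragedPropagator (dirichlet nsq_GradOp_mulVec re_star_dotProduct_le)
open Summit.QuantumFields.BalabanUV.T4Continuum.RegionScalarCompression (QOm)
open Summit.QuantumFields.BalabanUV.T4Continuum.RegionGaugeFixedVector (starReg curlR gradR avgR grad₁R avgR_mul_gradR curlR_mul_gradR)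
open Summit.QuantumFields.BalabanUV.T4Continuum.RegionGaugeSliceOrth (OrthSliceCoercive le_of_le_sqrt_mul_sqrt div_const_of_orth)
open Summit.QuantumFields.BalabanUV.T4Continuum.RegionGaugeSliceOrthRegion (QOm_mul_conjTranspose nsq_gradR_mulVec)
open Summit.QuantumFields.BalabanUV.T4Continuum.RegionBlockExtension (blockExt extFun QOm_blockExt ext_blockExt dirichlet_extFun_le Cext)
open Summit.QuantumFields.BalabanUV.Beta.GAN24.DirichletBoxTrace (blockReg)

variable {d : ℕ} (n : ℕ) [NeZero n] (M : Fin d → ℕ) [hM : ∀ μ, NeZero (M μ)] (a : ℝ) (S : Tor M → Prop) [DecidablePred S]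

/-! ## §1 Dictionary -/

/-- the unit gradient of a block function on `S` is the unit gradient of its zero-extension. [folklore] -/
theorem grad1R_mulVec (g : {y // S y} → ℂ) : grad₁R M S *ᵥ g = GradOp M 1 *ᵥ ext S g := by
  funext b
  simp only [grad₁R, Matrix.mulVec, dotProduct, Matrix.submatrix_apply, id]
  rw [← Fintype.sum_subtype_add_sum_subtype S (fun y => GradOp M 1 b y * ext S g y)]
  have h2 : ∑ y : {y // ¬ S y}, GradOp M 1 b y * ext S g y = 0 :=
    Finset.sum_eq_zero fun y _ => by rw [ext_apply_of_not S g y.2, mul_zero]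
  rw [h2, add_zero]
  exact Finset.sum_congr rfl fun y _ => by rw [ext_apply_of]

/-- `0 < Cext d`. [folklore] -/
theorem Cext_pos (d : ℕ) : 0 < Cext d := by unfold Cext; positivity

/-- **THE ENERGY OF THE EXTENSION ON THE REGION CARRIERS**: `nsq (∂_Ω E g) ≤ Cext d·n^d·nsq (∇₁g)`. [folklore] -/
theorem nsq_gradR_blockExt_le (hn : 2 ≤ n) (g : {y // S y} → ℂ) :
    nsq (gradR n M S *ᵥ blockExt n M S g) ≤ Cext d * ((n : ℝ) ^ d * nsq (grad₁R M S *ᵥ g)) := by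
  rw [nsq_gradR_mulVec, ext_blockExt, grad1R_mulVec]
  exact dirichlet_extFun_le n M S hn g

/-! ## §2 The two-scale estimate -/

/-- **THE TWO-SCALE ELLIPTIC ESTIMATE**: a Dirichlet scalar on `Ω` whose region Laplacian is block-constant (`∂_Ωᴴ∂_Ωφ = Q′_Ωᴴc`) obeys
`nsq (∂_Ωφ) ≤ Cext d·n^d·nsq (Q ∂_Ωφ)` — the fine Dirichlet energy is controlled by the coarse energy of the block averages, uniformly in
`n ≥ 2`, the torus and the block set. [folklore] -/
theorem nsq_gradR_le_of_lap_const (hn : 2 ≤ n) (φ : {x // blockReg n M S x} → ℂ) (c : {y // S y} → ℂ)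
    (hφ : (gradR n M S)ᴴ *ᵥ (gradR n M S *ᵥ φ) = (QOm n M S)ᴴ *ᵥ c) :
    nsq (gradR n M S *ᵥ φ) ≤ Cext d * ((n : ℝ) ^ d * nsq (avgR n M S *ᵥ (gradR n M S *ᵥ φ))) := by
  set ψ := QOm n M S *ᵥ φ with hψ
  set E := blockExt n M S ψ with hE
  -- `nsq (∂φ) = ⟨∂E, ∂φ⟩`
  have e : ((nsq (gradR n M S *ᵥ φ) : ℝ) : ℂ) = star (gradR n M S *ᵥ E) ⬝ᵥ (gradR n M S *ᵥ φ) := by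
    rw [← star_dotProduct_self, star_mulVec_dotProduct, hφ, dotProduct_mulVec_eq_star_conjTranspose_mulVec,
      Matrix.conjTranspose_conjTranspose, ← hψ, ← QOm_blockExt n M S ψ, ← hE, star_mulVec_dotProduct, ← hφ,
      dotProduct_mulVec_eq_star_conjTranspose_mulVec, Matrix.conjTranspose_conjTranspose]
  have h1 : nsq (gradR n M S *ᵥ φ) ≤ Real.sqrt (nsq (gradR n M S *ᵥ φ)) * Real.sqrt (nsq (gradR n M S *ᵥ E)) := by
    have h := re_star_dotProduct_le (gradR n M S *ᵥ E) (gradR n M S *ᵥ φ)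
    rw [← e, Complex.ofReal_re] at h
    rw [mul_comm]; exact h
  have h2 : nsq (gradR n M S *ᵥ φ) ≤ nsq (gradR n M S *ᵥ E) := le_of_le_sqrt_mul_sqrt (nsq_nonneg _) (nsq_nonneg _) h1
  have h3 := nsq_gradR_blockExt_le n M S hn ψ
  have h4 : grad₁R M S *ᵥ ψ = avgR n M S *ᵥ (gradR n M S *ᵥ φ) := by
    rw [hψ, Matrix.mulVec_mulVec, Matrix.mulVec_mulVec, avgR_mul_gradR]
  rw [← hE, h4] at h3
  exact h2.trans h3

/-! ## §3 The gradient sector of the orthogonal-slice inequality -/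

/-- **THE DISPLAYED W1 INEQUALITY HOLDS ON PURE GAUGES**: for every `A = ∂_Ωφ` orthogonal to the residual gauge directions
`∂_Ω N(Q′_Ω)`, `(a/Cext d)·nsq A ≤ nsq (curlR A) + a n^d·nsq (avgR A)` (`0 ≤ a`, `2 ≤ n`), uniformly in `n`, `M`, `S`. [folklore] -/
theorem orthSlice_gradient (hn : 2 ≤ n) (ha : 0 ≤ a) (φ : {x // blockReg n M S x} → ℂ)
    (horth : ∀ lam : {x // blockReg n M S x} → ℂ, QOm n M S *ᵥ lam = 0 →
      star (gradR n M S *ᵥ lam) ⬝ᵥ (gradR n M S *ᵥ φ) = 0) :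
    a / Cext d * nsq (gradR n M S *ᵥ φ)
      ≤ nsq (curlR n M S *ᵥ (gradR n M S *ᵥ φ)) + a * (n : ℝ) ^ d * nsq (avgR n M S *ᵥ (gradR n M S *ᵥ φ)) := by
  have hθ : (((n : ℝ) ^ d)⁻¹ : ℝ) ≠ 0 := inv_ne_zero (pow_ne_zero d (by exact_mod_cast NeZero.ne n))
  have hφ := div_const_of_orth (gradR n M S) (QOm n M S) (QOm_mul_conjTranspose n M S) hθ (gradR n M S *ᵥ φ) horth
  have h := nsq_gradR_le_of_lap_const n M S hn φ _ hφ
  have hC := Cext_pos d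
  have hcurl := nsq_nonneg (curlR n M S *ᵥ (gradR n M S *ᵥ φ))
  have hkey : a / Cext d * nsq (gradR n M S *ᵥ φ) ≤ a * (n : ℝ) ^ d * nsq (avgR n M S *ᵥ (gradR n M S *ᵥ φ)) := by
    calc a / Cext d * nsq (gradR n M S *ᵥ φ)
        ≤ a / Cext d * (Cext d * ((n : ℝ) ^ d * nsq (avgR n M S *ᵥ (gradR n M S *ᵥ φ)))) :=
          mul_le_mul_of_nonneg_left h (div_nonneg ha hC.le)
      _ = a * (n : ℝ) ^ d * nsq (avgR n M S *ᵥ (gradR n M S *ᵥ φ)) := by field_simp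
  linarith

/-- the same for `A` given directly as a gradient with block-constant region divergence. [folklore] -/
theorem orthSlice_gradient_of_lap_const (hn : 2 ≤ n) (ha : 0 ≤ a) (φ : {x // blockReg n M S x} → ℂ) (c : {y // S y} → ℂ)
    (hφ : (gradR n M S)ᴴ *ᵥ (gradR n M S *ᵥ φ) = (QOm n M S)ᴴ *ᵥ c) :
    a / Cext d * nsq (gradR n M S *ᵥ φ)
      ≤ nsq (curlR n M S *ᵥ (gradR n M S *ᵥ φ)) + a * (n : ℝ) ^ d * nsq (avgR n M S *ᵥ (gradR n M S *ᵥ φ)) := by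
  have h := nsq_gradR_le_of_lap_const n M S hn φ c hφ
  have hC := Cext_pos d
  have hcurl := nsq_nonneg (curlR n M S *ᵥ (gradR n M S *ᵥ φ))
  have hkey : a / Cext d * nsq (gradR n M S *ᵥ φ) ≤ a * (n : ℝ) ^ d * nsq (avgR n M S *ᵥ (gradR n M S *ᵥ φ)) := by
    calc a / Cext d * nsq (gradR n M S *ᵥ φ)
        ≤ a / Cext d * (Cext d * ((n : ℝ) ^ d * nsq (avgR n M S *ᵥ (gradR n M S *ᵥ φ)))) :=
          mul_le_mul_of_nonneg_left h (div_nonneg ha hC.le)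
      _ = a * (n : ℝ) ^ d * nsq (avgR n M S *ᵥ (gradR n M S *ᵥ φ)) := by field_simp
  linarith

end Summit.QuantumFields.BalabanUV.T4Continuum.RegionGradientTwoScale

end
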